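import Summits.QuantumFields.YangMills.Theorems.UnitScaleTiltHalvingP1FlatCoreTopRowsLocal
import Summits.QuantumFields.YangMills.Theorems.UnitScaleTiltHalvingP1FlatCoreFrameLinRealLocal
import Summits.QuantumFields.YangMills.Theorems.UnitScaleTiltHalvingP1FlatCoreFrameLinStar
import HarnessLib

/-!
# Line H (`BirthV10.stub_halvingStep`, stmt-QuantumFields-19200), J4c **(T4b) FILE 3b: THE REALITY ROW OF THE TOP MEMBER FROM THE LOCAL TOWER** — the
# hypothesis `hTopReal` of ✓`P1FlatCoreTopStepTorus.hFP_kLevel_top_RD` (block (E) row 3) DISCHARGED from ★w3-19936 g6's LOCAL reality row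
# ✓`P1FlatCoreFrameLinRealLocal.Cnl_negStar_local` through the site family of ✓`P1FlatCoreTopRowsLocal` §1

Cell `ym3-torus` (HUMAN RULING D-0037: YM₃ on T³ is ladder rung R3, NOT the Clay problem), width seat `ym-ust-19936-w8` (typed by gen 2, filed by gen 3).
`--supports stmt-QuantumFields-19200 --as helper`; THEOREMS ONLY (0 `def`, 0 `sorry`); count-neutral; nothing here claims `core′`, the stub, the crux or the gap.

WHAT.  ★★ `topReal_of_local` — the `hTopReal` text of ✓`hFP_kLevel_top_RD` at a top label `yc`: `C(−l₀⋆) = −C(l₀)⋆` for the top nonlinear part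
`C(m) := log κf(m)_k(π_k yc) − (Q′_k m)(π_k yc)`, from ✓`P1FlatCoreFrameLinRealLocal.Cnl_negStar_local` (C⋆-algebra, unitary stairs `hWu`) on the family
`S^{yc} j := {π_j z | ⌊z ∕ L^{k−j}⌋ = yc}` of ✓`P1FlatCoreTopRowsLocal` §1 (`emb_mem_family`, `stairEnd_mem_family`, `coverAt_mem_family`), its disc conditions
discharged by the size row `‖log κ_j‖ ≤ α₄ + ω` (✓`P1FlatCoreFrameLinStar.exp_mlog_and_norm_mlog_effGauge_le_local`, fed by `sup_on_family`∕`osc_on_family`) and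
✓`P1FlatCoreFrameLinReal.norm_stairRel_sub_one_le_twelfth`∕`norm_exp_sub_one_le_twelfth` under the windows `160(α₄ + δ + 5ω) ≤ ¼`, `δ ≤ 1∕12`,
`2δ + 4(α₄ + ω) ≤ 1∕24` (`ω := d·L·α₄∕2`).  This is the v1.2 row announced for ✓`…TopRowsLocal` (rows 1–2 = `top121_of_local`, `top125_of_local` there),
filed as its own module because the 400-line budget of a Theorems file is reached; same namespace, so `P1FlatCoreTopRowsLocal.topReal_of_local` is its name.
HONEST SCOPE.  Bookkeeping; the analysis is ★w3-19936 g6's tower induction (F4∕F4-local).  Nothing of [Balaban1985RegularSpaces] Prop. 5 ∕ Sect. E is proved here.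

References: T. Bałaban, CMP **99** (1985) 75–102 [Balaban1985RegularSpaces] (Sect. E (1.111), (1.116), (1.120)–(1.121) pp.95–96); CMP **98** (1985) 17–51
[Balaban1985Averaging] ((97)–(100) p.32, (110) p.34).
-/

set_option autoImplicit false

noncomputable section

open scoped BigOperators
open NormedSpace

namespace Summit.QuantumFields.YangMills.Theorems.P1FlatCoreTopRowsLocal

open Literature.MathematicalPhysics.QuantumFieldTheory.Balaban1983to89
open T4Continuum BlockAveraging ExpMeanLog MatrixLog
open B10Eq27TorusAxialLog (holT gaugeActT)
open LatticeFieldCalculus (siteAvgIter)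
open B15Eq112TorusCover (cover)
open B14DomainGeom (Pt)
open Node00 (coverAt coverAt_zero emb_coverAt blockMap_blockMap)
open Literature.MathematicalPhysics.QuantumLattice (blockMap blockBase blockSites mem_blockSites_iff blockMap_blockBase_add_of_lt)
open B7Prop1Explicit (e l1)
open B7Prop1Local (InBox)
open B8Ineq130 (tlo thi)
open BlockAveragingEMLLinearised (walkEnd_emb_stairWord_eq_blockSite)
open Summit.QuantumFields.YangMills.Theorems.Prop8ChartDoubleBar (vframeU dbarIterU)

variable {P : Params}


/-! ## §5 (v1.2) The reality row of the top member, from ★w3-19936 g6's LOCAL reality row ✓`P1FlatCoreFrameLinRealLocal.Cnl_negStar_local` -/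

section RowsReal

open Summit.QuantumFields.YangMills.Theorems.P1FlatCoreFrameLinRealLocal (Cnl_negStar_local)
open Summit.QuantumFields.YangMills.Theorems.P1FlatCoreFrameLinReal (norm_stairRel_sub_one_le_twelfth norm_exp_sub_one_le_twelfth)
open Summit.QuantumFields.YangMills.Theorems.P1FlatCoreFrameLinStar (exp_mlog_and_norm_mlog_effGauge_le_local)

/-- ★★ **THE REALITY ROW OF THE TOP MEMBER FROM THE LOCAL TOWER** — the `hTopReal` text of ✓`hFP_kLevel_top_RD` at a top label `yc`:
`C(−l₀⋆) = −C(l₀)⋆` for the top nonlinear part `C(m) := log κf(m)_k(π_k yc) − (Q′_k m)(π_k yc)`, from ★w3-19936 g6's ✓`P1FlatCoreFrameLinRealLocal.Cnl_negStar_local`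
(C⋆-algebra, unitary stairs `hWu`), its disc conditions discharged by the size row `‖log κ_j‖ ≤ α₄ + ω` (✓`P1FlatCoreFrameLinStar.exp_mlog_and_norm_mlog_effGauge_le_local`)
and ✓`P1FlatCoreFrameLinReal.norm_stairRel_sub_one_le_twelfth`∕`norm_exp_sub_one_le_twelfth` under the windows `δ ≤ 1∕12`, `2δ + 4(α₄ + ω) ≤ 1∕24`.
[cite: Balaban1985RegularSpaces, Sect. E (1.111), (1.116) pp.95-96] -/
theorem topReal_of_local {𝔹 : Type*} [CStarAlgebra 𝔹] [Nonempty (Idx P)] {k : ℕ} (hk : k ≤ P.m + P.K) (W : GaugeField P 0 𝔹ˣ)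
    (κf : (Site P 0 → 𝔹) → (i : ℕ) → GaugeTransf P i 𝔹ˣ)
    (hs : ∀ (m : Site P 0 → 𝔹) (i : ℕ) (y : Site P (i + 1)),
      κf m (i + 1) y = (vframeU (gaugeActT (κf m i) (dbarIterU i W)) y)⁻¹ * κf m i (emb y) * vframeU (dbarIterU i W) y)
    (h0 : ∀ (m : Site P 0 → 𝔹) (x : Site P 0), ((κf m 0 x : 𝔹ˣ) : 𝔹) = exp (m x))
    {α₄ δ : ℝ} (hα₄ : 0 ≤ α₄) (hδ : 0 ≤ δ) (yc : Pt P.d)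
    (hH : ∀ j < k, ∀ z : Pt P.d, blockMap (P.L ^ (k - (j + 1))) z = yc → ∀ idx : Idx P,
      ‖((holT (dbarIterU j W) (emb (coverAt P (j + 1) z)) (stairWord idx.2.1 (off idx.1)) : 𝔹ˣ) : 𝔹) - 1‖ ≤ δ)
    (hWu : ∀ j < k, ∀ z : Pt P.d, blockMap (P.L ^ (k - (j + 1))) z = yc → ∀ idx : Idx P,
      ((holT (dbarIterU j W) (emb (coverAt P (j + 1) z)) (stairWord idx.2.1 (off idx.1)) : 𝔹ˣ) : 𝔹) ∈ unitary 𝔹)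
    (hr : 160 * (α₄ + δ + 5 * ((P.d : ℝ) * P.L * α₄ / 2)) ≤ 1 / 4) (hδ12 : δ ≤ 1 / 12)
    (hw : 2 * δ + 4 * (α₄ + (P.d : ℝ) * P.L * α₄ / 2) ≤ 1 / 24)
    (l₀ : Site P 0 → 𝔹)
    (hb : ∀ x : Pt P.d, InBox (tlo P.L yc k) (thi P.L yc k) x → ‖l₀ (cover P x)‖ ≤ α₄)
    (hg : ∀ (x : Pt P.d) (ν : Fin P.d), InBox (tlo P.L yc k) (thi P.L yc k) x → InBox (tlo P.L yc k) (thi P.L yc k) (x + e ν) →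
      ‖l₀ (cover P (x + e ν)) - l₀ (cover P x)‖ ≤ α₄ * ((P.L : ℝ) ^ k)⁻¹) :
    mlog ((κf (fun s => -star (l₀ s)) k (coverAt P k yc) : 𝔹ˣ) : 𝔹) - siteAvgIter k (fun s => -star (l₀ s)) (coverAt P k yc) =
      -star (mlog ((κf l₀ k (coverAt P k yc) : 𝔹ˣ) : 𝔹) - siteAvgIter k l₀ (coverAt P k yc)) := by
  set ω : ℝ := (P.d : ℝ) * P.L * α₄ / 2 with hω
  have hω0 : 0 ≤ ω := by positivity
  let S : (j : ℕ) → Set (Site P j) := fun j => {w | ∃ z : Pt P.d, blockMap (P.L ^ (k - j)) z = yc ∧ w = coverAt P j z}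
  have hSe : ∀ j < k, ∀ y ∈ S (j + 1), emb y ∈ S j := fun j hj y hy => by
    obtain ⟨z, hz, rfl⟩ := hy; obtain ⟨w, hw, he⟩ := emb_mem_family hj hk yc z hz; exact ⟨w, hw, he⟩
  have hSs : ∀ j < k, ∀ y ∈ S (j + 1), ∀ idx : Idx P, walkEnd (emb y) (stairWord idx.2.1 (off idx.1)) ∈ S j := fun j hj y hy idx => by
    obtain ⟨z, hz, rfl⟩ := hy; obtain ⟨w, hw, he⟩ := stairEnd_mem_family hj hk yc z hz idx; exact ⟨w, hw, he⟩
  have hH' : ∀ j < k, ∀ y ∈ S (j + 1), ∀ idx : Idx P,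
      ‖((holT (dbarIterU j W) (emb y) (stairWord idx.2.1 (off idx.1)) : 𝔹ˣ) : 𝔹) - 1‖ ≤ δ := by
    rintro j hj y ⟨z, hz, rfl⟩ idx; exact hH j hj z hz idx
  have hWu' : ∀ j < k, ∀ y ∈ S (j + 1), ∀ idx : Idx P,
      ((holT (dbarIterU j W) (emb y) (stairWord idx.2.1 (off idx.1)) : 𝔹ˣ) : 𝔹) ∈ unitary 𝔹 := by
    rintro j hj y ⟨z, hz, rfl⟩ idx; exact hWu j hj z hz idx
  have hWs : ∀ j < k, ∀ y ∈ S (j + 1), ∀ idx : Idx P,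
      ‖((holT (dbarIterU j W) (emb y) (stairWord idx.2.1 (off idx.1)) : 𝔹ˣ) : 𝔹) - 1‖ ≤ 1 / 12 :=
    fun j hj y hy idx => (hH' j hj y hy idx).trans hδ12
  have hyc : coverAt P k yc ∈ S k := coverAt_mem_family k yc
  -- the size row `‖log κ_j‖ ≤ α₄ + ω` on the family
  have hsize := exp_mlog_and_norm_mlog_effGauge_le_local W (κf l₀) (hs l₀) l₀ (h0 l₀) hα₄ hδ hω0 k S hSe hSs
    (sup_on_family yc l₀ hb) hH' (osc_on_family hk yc l₀ hα₄ hg) hr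
  -- disc conditions
  have hdisc : ∀ i < k, ∀ y ∈ S (i + 1), ∀ idx : Idx P,
      ‖((holT (dbarIterU i W) (emb y) (stairWord idx.2.1 (off idx.1)) *
          ((κf l₀ i (walkEnd (emb y) (stairWord idx.2.1 (off idx.1))))⁻¹ * κf l₀ i (emb y)) : 𝔹ˣ) : 𝔹) - 1‖ ≤ 1 / 12 := by
    intro i hi y hy idx
    have hx := hsize i hi.le _ (hSs i hi y hy idx)
    have hz := hsize i hi.le _ (hSe i hi y hy)
    exact norm_stairRel_sub_one_le_twelfth _ (κf l₀ i) (fun w => mlog ((κf l₀ i w : 𝔹ˣ) : 𝔹)) _ _ hx.1.symm hz.1.symm (hH' i hi y hy idx)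
      hx.2 hz.2 (by linarith) hw
  have htop : ‖((κf l₀ k (coverAt P k yc) : 𝔹ˣ) : 𝔹) - 1‖ ≤ 1 / 12 := by
    have h := hsize k le_rfl _ hyc
    rw [← h.1]
    exact norm_exp_sub_one_le_twelfth _ (h.2.trans (by linarith))
  exact Cnl_negStar_local W κf hs h0 l₀ k S hSe hSs hWu' hWs hdisc (coverAt P k yc) hyc htop

end RowsReal

end Summit.QuantumFields.YangMills.Theorems.P1FlatCoreTopRowsLocal

end
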